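import Summits.Ventures.GridStability.Models.ClassicalSwingLurie
import Summits.Ventures.GridStability.Models.Kundur2A
import Literature.MathematicalPhysics.PowerSystems.LossyMultimachineLurieSplitLines

/-!
# GridStability/Models/Kundur2ASplitLurieLines — the UNIFORM-DAMPING reading `toModelRel λ 0` of a recast record
# AS lit-6's UNORDERED-LINES split Lur'e system (Pai (3.43)–(3.45)), generic + the instance
# «KUNDUR2A-CSG-pre-λ-h12», `λ = 1/10` (★ #22's model: Chow–Sanchez-Gasca two-area four-machine, lossy Kron reduction,
# transfer conductances KEPT)

Cell `gridfusion` (LADDER-GRIDFUSION G2.c lossy Lur'e tier, Kundur-two-area rung of memo §4); seat gridfusion-lit-6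
(g10).  Companion of `Models/WSCC9SplitLurieLines.lean` (lit-6 g9, p558722): there the record carries its damping
(`WSCC9.postB_SPdamp`, `d.toModel`); model-1's census records `Kundur2A.csgPre` / `NE39.preLossless` carry the
printed `D = 0` and are read with a DECLARED uniform damping ratio through model-1's `RecastData.toModelRel λ a′`
(`D_i = λM_i`, `P_i = P′_i + M_i a′`).  This file gives that reading its unordered-lines split presentation:

* generic (`RecastData`, any `n`, any `λ`): `splitLurieLinesSystemRel λ δˢ := (d.toModelRel λ 0).toLitNode.
  toSplitLurieLines δˢ` (lit-6 `LossyMultimachineLurieSplitLines.lean` p510572: one SINE and one COSINE channel per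
  line `p < q` feeding both machines with the RATIONAL weights `C_pq = E_pE_qB_pq`, `D_pq = E_pE_qG_pq`; columns
  `p ≥ q` zero; states `(ω | σ) = Fin (n+1) ⊕ Fin n`, channels `(Fin (n+1) × Fin (n+1)) ⊕ (Fin (n+1) × Fin (n+1))`),
  its definitional unfoldings, and the HYPOTHESIS-FREE bridge `hasDerivWithinAt_lurieState_linesRel`: along every
  solution of `d.toModelRel λ 0` on `univ` the Lur'e state `d.lurieState δˢ` solves the split field (only the A1
  data `EqData δˢ`; no damping-pattern, losslessness or observability hypothesis);
* generic: `abs_angleOf_sub_lt_pi_div_two_of_cd_pos` — a line angle `θ*_a − θ*_b` of the A1 equilibrium lies in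
  the Vu–Turitsyn window `(−π/2, π/2)` as soon as both node cosines and the line cosine `cd a b` are positive
  (model-1's `abs_angleOf_sub_lt_pi` + `cos_angleOf_sub`; replaces the same-sign hypothesis of
  `abs_angleOf_sub_lt_pi_div_two`, which the two-area record violates: its node angles have both signs);
* the instance `Kundur2A.splitLurieLinesSystem` (`λ = 1/10`, `δˢ = csgPre.angleOf`; 7 states, 32 channels, the 12
  with `p < q` active), its unfoldings, the bridge `Kundur2A.hasDerivWithinAt_lurieState_lines` for EVERY solution
  of `Kundur2A.csgPre.toModelRel (1/10) 0`, the exact channel trigonometry `sin/cos(θ*_p − θ*_q) = sd/cd p q` and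
  `|θ*_p − θ*_q| < π/2` for all pairs (kernel: every `c_i > 0`, every `cd p q > 0`).

THREE COLUMNS.  CERTIFIED: nothing (identities and a chain rule).  MODELLED: ★ #22's tokens verbatim — model-1's
classical model `Kundur2A.csgPre.toModelRel (1/10) a′` (Kron-reduced WITH constant-impedance loads, transfer
conductances kept, K rounded h12, scaled time with unit inertias, ASSUMED UNIFORM DAMPING RATIO `λ = 1/10`; census
label «synthetic uniform damping on the printed two-area network», never a sentence about the printed `D = 0`
system); here `a′ = 0` (the common acceleration only shifts every speed by `a′/λ`).  VALIDATED: nothing.  No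
sentence of this file says a grid is stable.
[cite: Pai1981, §3.6.3 eqs. (3.43)–(3.45); SauerPai1998, §6.10 eqs. (6.242)–(6.244)]
-/

noncomputable section

open Real Set Filter Topology Finset
open Literature.MathematicalPhysics.PowerSystems
open Literature.MathematicalPhysics.PowerSystems.LyapunovFunctionFamily (System)

namespace Summit.Ventures.GridStability.Models

namespace RecastData

variable {n : ℕ} (d : RecastData n) {δs : Fin (n + 1) → ℝ}

/-- The UNORDERED-LINES split Lur'e system of the uniform-damping reading `toModelRel λ 0` at an equilibrium
`δˢ`: lit-6's `toSplitLurieLines` of `(d.toModelRel λ 0).toLitNode`. [cite: Pai1981, §3.6.3 eqs. (3.43)–(3.45)] -/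
def splitLurieLinesSystemRel (lam : ℚ) (δs : Fin (n + 1) → ℝ) :
    System (Fin (n + 1) ⊕ Fin n) ((Fin (n + 1) × Fin (n + 1)) ⊕ (Fin (n + 1) × Fin (n + 1))) :=
  (d.toModelRel lam 0).toLitNode.toSplitLurieLines δs

/-- `A = [[−diag(D/M), 0], [refT, 0]]` (definitional unfolding; `D_i/M_i = λM_i/M_i`).
[cite: Pai1981, §3.6.3 eq. (3.45)] -/
theorem splitLurieLinesSystemRel_A (lam : ℚ) (δs : Fin (n + 1) → ℝ) :
    (d.splitLurieLinesSystemRel lam δs).A =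
      Matrix.fromBlocks (-Matrix.diagonal
        (fun i => (d.toModelRel lam 0).toLitNode.D i / (d.toModelRel lam 0).toLitNode.M i))
        0 (InternalNode.refT n) 0 := rfl

/-- `B = [lineInput; 0]` (definitional unfolding). [cite: Pai1981, §3.6.3 eq. (3.45) (the matrices B₁, B₂)] -/
theorem splitLurieLinesSystemRel_B (lam : ℚ) (δs : Fin (n + 1) → ℝ) :
    (d.splitLurieLinesSystemRel lam δs).B =
      Matrix.fromRows (d.toModelRel lam 0).toLitNode.lineInput 0 := rfl

/-- `C = [0 | pairIncidence; pairIncidence]` (definitional unfolding). [cite: Pai1981, §3.6.3 eq. (3.43)] -/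
theorem splitLurieLinesSystemRel_C (lam : ℚ) (δs : Fin (n + 1) → ℝ) :
    (d.splitLurieLinesSystemRel lam δs).C =
      Matrix.fromCols 0 (Matrix.fromRows (InternalNode.pairIncidence n) (InternalNode.pairIncidence n)) := rfl

/-- `δ*` is lit-6's `splitShift δˢ` (definitional unfolding). [cite: Pai1981, §3.6.3 eq. (3.44)] -/
theorem splitLurieLinesSystemRel_δs (lam : ℚ) (δs : Fin (n + 1) → ℝ) :
    (d.splitLurieLinesSystemRel lam δs).δs = InternalNode.splitShift δs := rfl

/-- The A1 angles are an equilibrium of `toModelRel λ 0` (injections `P′ + M·0`; plumbing). -/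
private theorem isEquilibrium_rel_zero (lam : ℚ) (hE : d.EqData δs) :
    (d.toModelRel lam 0).IsEquilibrium δs := by
  intro i
  have h := d.isEquilibrium_of_eqData hE i
  simp only [ClassicalSwing.Pe, ClassicalSwing.Ccoef, ClassicalSwing.Dcoef, toModel, toModelRel, mul_zero,
    add_zero] at h ⊢
  exact h

/-- **THE BRIDGE (uniform damping, unordered-lines presentation, chain rule).** Along EVERY solution `c` of
`d.toModelRel λ 0` on `univ` (transfer conductances kept, `D_i = λM_i`), with A1 data `δˢ`, the Lur'e state
`t ↦ lurieState δˢ (c t)` solves `ẋ = (d.splitLurieLinesSystemRel λ δˢ).field x` within every time set.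
[cite: Pai1981, §3.6.3 eq. (3.45)] -/
theorem hasDerivWithinAt_lurieState_linesRel (lam : ℚ) (hE : d.EqData δs)
    {c : ℝ → ClassicalSwing.State (n + 1)} (hc : (d.toModelRel lam 0).IsSolutionOn c univ) {s : Set ℝ} (t : ℝ) :
    HasDerivWithinAt (fun τ => d.lurieState δs (c τ))
      ((d.splitLurieLinesSystemRel lam δs).field (d.lurieState δs (c t))) s t :=
  (d.toModelRel lam 0).toLitNode.hasDerivWithinAt_lurieState_lines
    (((d.toModelRel lam 0).toLitNode_isEquilibrium_iff δs).2 (d.isEquilibrium_rel_zero lam hE))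
    ((d.toModelRel lam 0).isSolutionAt_toLitNode hc t)

/-- **Line angles in the Vu–Turitsyn window from positive cosines.** If both node cosines `c_a, c_b` and the line
cosine `cd a b = cos(θ*_a − θ*_b)` are positive, then `|θ*_a − θ*_b| < π/2` (each node angle lies in
`(−π/2, π/2)`, so the difference lies in `(−π, π)`, where a positive cosine forces `(−π/2, π/2)`).
[cite: VuTuritsyn2017, §4.1 (the polytope |δ_kj| < π/2)] -/
theorem abs_angleOf_sub_lt_pi_div_two_of_cd_pos (hE : d.EqData d.angleOf) {a b : Fin (n + 1)}
    (ha : 0 < d.c a) (hb : 0 < d.c b) (hcd : 0 < d.cd a b) : |d.angleOf a - d.angleOf b| < π / 2 := by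
  have hπ := d.abs_angleOf_sub_lt_pi ha hb
  by_contra hle
  push Not at hle
  have hcos : Real.cos |d.angleOf a - d.angleOf b| ≤ 0 :=
    Real.cos_nonpos_of_pi_div_two_le_of_le hle (by linarith [Real.pi_pos])
  rw [Real.cos_abs, d.cos_angleOf_sub hE] at hcos
  exact absurd hcos (not_le.2 (by exact_mod_cast hcd))

end RecastData

/-! ### Instance «KUNDUR2A-CSG-pre-λ-h12», `λ = 1/10` (transfer conductances KEPT), unordered-lines split -/

namespace Kundur2A

/-- The UNORDERED-LINES split Lur'e system of ★ #22's model `csgPre.toModelRel (1/10) 0` at its A1 equilibrium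
`csgPre.angleOf` (7 states `ω₀ … ω₃ | σ₁ σ₂ σ₃`; 32 channels: 16 sine, 16 cosine; ACTIVE = the six lines `p < q` in
each family; rational `A`, `B`, `C`). [cite: Pai1981, §3.6.3 eq. (3.45)] -/
def splitLurieLinesSystem : System (Fin 4 ⊕ Fin 3) ((Fin 4 × Fin 4) ⊕ (Fin 4 × Fin 4)) :=
  csgPre.splitLurieLinesSystemRel (1 / 10) csgPre.angleOf

/-- `A` of the instance (definitional unfolding). [cite: Pai1981, §3.6.3 eq. (3.45)] -/
theorem splitLurieLinesSystem_A : splitLurieLinesSystem.A =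
    Matrix.fromBlocks (-Matrix.diagonal
      (fun i => (csgPre.toModelRel (1 / 10) 0).toLitNode.D i / (csgPre.toModelRel (1 / 10) 0).toLitNode.M i))
      0 (InternalNode.refT 3) 0 := rfl

/-- `B` of the instance (definitional unfolding). [cite: Pai1981, §3.6.3 eq. (3.45)] -/
theorem splitLurieLinesSystem_B : splitLurieLinesSystem.B =
    Matrix.fromRows (csgPre.toModelRel (1 / 10) 0).toLitNode.lineInput 0 := rfl

/-- `C` of the instance (definitional unfolding). [cite: Pai1981, §3.6.3 eq. (3.43)] -/
theorem splitLurieLinesSystem_C : splitLurieLinesSystem.C =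
    Matrix.fromCols 0 (Matrix.fromRows (InternalNode.pairIncidence 3) (InternalNode.pairIncidence 3)) := rfl

/-- `δ*` of the instance is `splitShift csgPre.angleOf` (definitional unfolding). [cite: Pai1981, §3.6.3 eq. (3.44)] -/
theorem splitLurieLinesSystem_δs : splitLurieLinesSystem.δs = InternalNode.splitShift csgPre.angleOf := rfl

/-- **HYPOTHESIS-FREE bridge for ★ #22's model at `a′ = 0`**: every solution of `csgPre.toModelRel (1/10) 0` on
`univ` drives the Lur'e state along `Kundur2A.splitLurieLinesSystem`. [cite: Pai1981, §3.6.3 eq. (3.45)] -/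
theorem hasDerivWithinAt_lurieState_lines {c : ℝ → ClassicalSwing.State 4}
    (hc : (csgPre.toModelRel (1 / 10) 0).IsSolutionOn c univ) {s : Set ℝ} (t : ℝ) :
    HasDerivWithinAt (fun τ => csgPre.lurieState csgPre.angleOf (c τ))
      (splitLurieLinesSystem.field (csgPre.lurieState csgPre.angleOf (c t))) s t :=
  csgPre.hasDerivWithinAt_lurieState_linesRel (1 / 10) csgPre_eqData hc t

/-- Exact channel sines: `sin(θ*_p − θ*_q) = sd p q` (rational) for the A1 equilibrium of record. -/
theorem sin_angleOf_sub (p q : Fin 4) :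
    Real.sin (csgPre.angleOf p - csgPre.angleOf q) = ((csgPre.sd p q : ℚ) : ℝ) :=
  (csgPre.sd_cast csgPre_eqData p q).symm

/-- Exact channel cosines: `cos(θ*_p − θ*_q) = cd p q` (rational). -/
theorem cos_angleOf_sub (p q : Fin 4) :
    Real.cos (csgPre.angleOf p - csgPre.angleOf q) = ((csgPre.cd p q : ℚ) : ℝ) :=
  (csgPre.cd_cast csgPre_eqData p q).symm

/-- Every node cosine of the record is positive (kernel). -/
theorem csgPre_c_pos : ∀ i : Fin 4, 0 < csgPre.c i := by decide +kernel

/-- Every line cosine `cd p q = c_pc_q + s_ps_q` of the record is positive (kernel; the line angles are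
≈ ±10.9°, ±0.2°). -/
theorem csgPre_cd_pos : ∀ p q : Fin 4, 0 < csgPre.cd p q := by decide +kernel

/-- Every line angle of the A1 equilibrium lies in the Vu–Turitsyn window: `|θ*_p − θ*_q| < π/2`. -/
theorem abs_angle_sub_lt (p q : Fin 4) : |csgPre.angleOf p - csgPre.angleOf q| < π / 2 :=
  csgPre.abs_angleOf_sub_lt_pi_div_two_of_cd_pos csgPre_eqData (csgPre_c_pos p) (csgPre_c_pos q)
    (csgPre_cd_pos p q)

end Kundur2A

end Summit.Ventures.GridStability.Models

end
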